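import Summits.MatrixMultiplication.MatrixMultiplication.Theses.SnSubsetDichotomy

/-!
# `SnSubsetDichotomy.SubgroupHostedEdge` — refuting the subgroup-hosted crux gives the target

Item `stmt-MatrixMultiplication-18340` (support of route `SnSubsetDichotomy`):

  `¬ SubgroupHostedSubsets → ThresholdSubsetTriples`.

`SubgroupHostedSubsets` says: for some `c > 0` and all large `n`, every TPP triple of subsets
`X₀, X₁, X₂ ⊆ S_n` hosted in three subgroups `H₀, H₁, H₂ ≤ S_n` of total size
`|H₀||H₁||H₂| ≤ (n!)^{3/2}·e^{c√n}` has `|X₀||X₁||X₂| ≤ (n!)^{3/2}·e^{-c√n}`.  Pushing a negation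
through the quantifiers, `¬ SubgroupHostedSubsets` hands us, for every `c > 0` and every `n₀`,
some `n ≥ n₀`, hosts `H`, and a hosted TPP triple `X` with `(n!)^{3/2}·e^{-c√n} < |X₀||X₁||X₂|`;
forgetting the hosts, `(X₀, X₁, X₂)` is a threshold TPP subset triple, i.e. the route target
`ThresholdSubsetTriples` (whence `ω(ℂ) = 2` by the deciding theorem `closes`).  This is the
analogue, for the crux `SubgroupHostedSubsets`, of the edges collected in
`negativeSideResistance_proof`.

No literature facts are used; the proof is pure logic (`¬ (a ≤ b) → b < a`).
-/

-- `Summit.<Summit>.<Problem>` is the tree's mandated summit-side namespace; for this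
-- single-conjunct summit the two coincide, so the file silences `dupNamespace`.
set_option linter.dupNamespace false

namespace Summit.MatrixMultiplication.MatrixMultiplication.Theorems

open Summit.MatrixMultiplication.MatrixMultiplication.Theses.SnSubsetDichotomy

/-- **Edge `¬ SubgroupHostedSubsets → ThresholdSubsetTriples`** (item
`stmt-MatrixMultiplication-18340`).  Fix `c > 0` and `n₀`.  If there were no threshold TPP subset
triple at scale `c` beyond `n₀`, then `(c, n₀)` would witness `SubgroupHostedSubsets` (the hosting
hypotheses are simply not needed), contradicting the assumption; so some `n ≥ n₀` carries hosts
`H` and a hosted TPP triple `X` with `(n!)^{3/2}·e^{-c√n} < |X 0||X 1||X 2|`, and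
`(X 0, X 1, X 2)` is the required triple — forget the hosts. -/
theorem subgroupHostedEdge_proof :
    Summit.MatrixMultiplication.MatrixMultiplication.Theses.SnSubsetDichotomy.SubgroupHostedEdge := by
  unfold Summit.MatrixMultiplication.MatrixMultiplication.Theses.SnSubsetDichotomy.SubgroupHostedEdge
  intro h c hc n₀
  by_contra hcon
  refine h ⟨c, hc, n₀, fun n hn _H _hH X _hX hTPP => ?_⟩
  by_contra hlt
  exact hcon ⟨n, hn, X 0, X 1, X 2, hTPP, lt_of_not_ge hlt⟩

end Summit.MatrixMultiplication.MatrixMultiplication.Theorems
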